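import Mathlib
import Literature.AlgebraicGeometry.Motives.VarietiesProjectiveSpaceProofs
import HarnessLib

/-!
# `EquisingularLift` (crux stmt-ResolutionOfSingularities-15660), line `strata-split`,
# stub `stub_projectiveAmbientSmoothProper`: `ℙⁿ_O → Spec O` is smooth and proper

For any commutative ring `O` and `n : ℕ`, projective `n`-space
`ℙⁿ_O = Proj O[x₀, …, xₙ]` with its structure morphism
`Proj.toSpecZero 𝒜 ≫ Spec (O → 𝒜 0) : Proj O[x₀,…,xₙ] → Spec (O[x]₀) → Spec O`
(`𝒜 = MvPolynomial.homogeneousSubmodule (Fin (n + 1)) O`, the grading by degree) is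

* **smooth** (indeed smooth of relative dimension `n`, Hartshorne III §10 Example 10.0.1): Mathlib's
  `SmoothOfRelativeDimension n` is Zariski-local at the source; the standard charts
  `D₊(xᵢ) ≅ Spec (O[x₀,…,xₙ]_{xᵢ})₀` cover `ℙⁿ_O` because `x₀, …, xₙ` generate the irrelevant ideal
  (Mathlib `Proj.affineOpenCoverOfIrrelevantLESpan`), on a chart the structure morphism is `Spec` of
  `O → O[x]₀ → (O[x]_{xᵢ})₀` (Mathlib `Proj.awayι_toSpecZero`), and `(O[x]_{xᵢ})₀ ≅ O[y₁,…,yₙ]` is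
  standard smooth of relative dimension `n` over `O`
  (`Literature.AlgebraicGeometry.Motives.ProjectiveSpace.algebraMap_isStandardSmoothOfRelativeDimension`,
  valid over any commutative ring, for the `O`-algebra structure
  `Literature.AlgebraicGeometry.Motives.ProjBaseChange.algebraBase`, used through `letI`);
* **proper** (Hartshorne II Thm. 4.9): Mathlib proves `Proj.toSpecZero 𝒜` proper when `A` is of
  finite type over `𝒜 0` (here `O[x₀,…,xₙ]` is of finite type over `O`, a fortiori over `O[x]₀`), and
  `Spec (O[x]₀) → Spec O` is an isomorphism since the degree-`0` part of `O[x₀,…,xₙ]` is `O`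
  (a polynomial of total degree `0` is constant).

The tree has the field case
(`Literature.AlgebraicGeometry.Motives.ProjectiveSpace.smoothOfRelativeDimension_projToSpec`,
`Literature.NumberTheory.Transcendental.isProper_projectiveSpace_hom`); the proofs below are the
same, run over a commutative ring. Only Mathlib's `MvPolynomial.gradedAlgebra` is made a local
instance (needed to form `Proj O[x₀,…,xₙ]`, as in `Literature.AlgebraicGeometry.Motives.projectiveSpace`).

[cite: Hartshorne1977, II Thm. 4.9 and III §10 Example 10.0.1]
-/

noncomputable section

set_option linter.dupNamespace false -- mandated namespace of this single-conjunct summit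

open CategoryTheory AlgebraicGeometry MvPolynomial HomogeneousLocalization
open Literature.AlgebraicGeometry.Motives

attribute [local instance] MvPolynomial.gradedAlgebra

namespace Summit.ResolutionOfSingularities.ResolutionOfSingularities.Cruxes.EquisingularLift.StrataSplit

universe u

/-! ### The degree-`0` part of `O[x₀, …, xₙ]` is `O`; properness ingredients -/

/-- The degree-`0` part of `O[xᵢ | i ∈ σ]` consists of the constants: `algebraMap O (𝒜 0)` is
bijective for `𝒜 = MvPolynomial.homogeneousSubmodule σ O`, over any commutative ring `O`
(injective as it is `C`; surjective as a polynomial of total degree `0` is constant).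
[cite: Hartshorne1977, II Ex. 2.5.1] -/
theorem algebraMap_homogeneousSubmodule_zero_bijective (σ : Type*) (O : Type*) [CommRing O] :
    Function.Bijective (algebraMap O (MvPolynomial.homogeneousSubmodule σ O 0)) := by
  -- adapted from `Literature.NumberTheory.Transcendental.algebraMap_homogeneousSubmodule_zero_bijective`
  refine ⟨fun a b h ↦ by simpa using congrArg Subtype.val h, ?_⟩
  rintro ⟨p, hp⟩
  rw [MvPolynomial.mem_homogeneousSubmodule, ← MvPolynomial.totalDegree_zero_iff_isHomogeneous,
    MvPolynomial.totalDegree_eq_zero_iff_eq_C] at hp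
  exact ⟨p.coeff 0, Subtype.ext (by simpa using hp.symm)⟩

/-- `O[xᵢ | i ∈ σ]` is of finite type over its degree-`0` part for `σ` finite (it is of finite
type over `O`, and `O → O[x]₀ → O[x]` is a scalar tower); this is the hypothesis of Mathlib's
properness of `Proj.toSpecZero`. [folklore] -/
theorem finiteType_homogeneousSubmodule_zero (σ : Type*) [Finite σ] (O : Type*) [CommRing O] :
    Algebra.FiniteType (MvPolynomial.homogeneousSubmodule σ O 0) (MvPolynomial σ O) :=
  haveI : IsScalarTower O (MvPolynomial.homogeneousSubmodule σ O 0) (MvPolynomial σ O) :=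
    IsScalarTower.of_algebraMap_eq (R := O) (S := MvPolynomial.homogeneousSubmodule σ O 0)
      (A := MvPolynomial σ O) fun _ ↦ rfl
  Algebra.FiniteType.of_restrictScalars_finiteType O _ _

/-- `Spec (O[x₀,…,xₙ]₀) ⟶ Spec O` is an isomorphism (`𝒜 0 = O`,
`algebraMap_homogeneousSubmodule_zero_bijective`). [cite: Hartshorne1977, II Ex. 2.5.1] -/
theorem isIso_specMap_algebraMap_homogeneousSubmodule_zero (n : ℕ) (O : Type u) [CommRing O] :
    IsIso (Spec.map (CommRingCat.ofHom
      (algebraMap O (MvPolynomial.homogeneousSubmodule (Fin (n + 1)) O 0)))) := by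
  have : IsIso (CommRingCat.ofHom
      (algebraMap O (MvPolynomial.homogeneousSubmodule (Fin (n + 1)) O 0))) := by
    rw [ConcreteCategory.isIso_iff_bijective]
    exact algebraMap_homogeneousSubmodule_zero_bijective (Fin (n + 1)) O
  infer_instance

/-! ### The standard charts cover `ℙⁿ_O`; smoothness of relative dimension `n` -/

/-- The variables `x₀, …, xₙ` generate the irrelevant ideal `(x₀, …, xₙ)` of `O[x₀, …, xₙ]`, over any
commutative ring `O` (Hartshorne II Prop. 2.5(b), proof: the `D₊(f)`, `f ∈ S₊` homogeneous, cover
`Proj S`; here `S₊ = (x₀,…,xₙ)`). [folklore] -/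
theorem irrelevant_le_span (n : ℕ) (O : Type u) [CommRing O] :
    (HomogeneousIdeal.irrelevant (MvPolynomial.homogeneousSubmodule (Fin (n + 1)) O)).toIdeal ≤
      Ideal.span (Set.range (X : Fin (n + 1) → MvPolynomial (Fin (n + 1)) O)) := by
  -- adapted from `Literature.AlgebraicGeometry.Motives.ProjectiveSpace.irrelevant_le_span` (field case)
  rw [HomogeneousIdeal.toIdeal_irrelevant_le]
  intro i hi p (hp : p ∈ MvPolynomial.homogeneousSubmodule (Fin (n + 1)) O i)
  change p ∈ Ideal.span _
  rw [← Set.image_univ, MvPolynomial.mem_ideal_span_X_image]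
  intro m hm
  have hdeg : m.degree = i := by
    rw [Finsupp.degree_eq_weight_one]
    exact hp (mem_support_iff.mp hm)
  by_contra! h
  refine hi.ne' (hdeg.symm.trans ((Finsupp.degree_eq_zero_iff m).mpr ?_))
  ext s
  simpa using h s

/-- **`ℙⁿ_O → Spec O` is smooth of relative dimension `n`** for any commutative ring `O`
(Hartshorne III §10 Example 10.0.1: «for any `Y`, `𝔸ⁿ_Y` and `ℙⁿ_Y` are smooth of relative dimension
`n` over `Y`»). Proof: `SmoothOfRelativeDimension n` is Zariski-local at the source, the charts
`D₊(xₛ) = Spec (O[x]_{xₛ})₀` cover (`Proj.affineOpenCoverOfIrrelevantLESpan`, `irrelevant_le_span`), on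
a chart the morphism is `Spec` of `O → O[x]₀ → (O[x]_{xₛ})₀` (`Proj.awayι_toSpecZero`), and this map
is standard smooth of relative dimension `n`, as `(O[x]_{xₛ})₀ ≅ O[y₁,…,yₙ]` over `O`
(`ProjectiveSpace.algebraMap_isStandardSmoothOfRelativeDimension`).
[cite: Hartshorne1977, III §10 Example 10.0.1] -/
theorem smoothOfRelativeDimension_toSpecZero_specMap (n : ℕ) (O : Type u) [CommRing O] :
    SmoothOfRelativeDimension n
      (Proj.toSpecZero (MvPolynomial.homogeneousSubmodule (Fin (n + 1)) O) ≫
        Spec.map (CommRingCat.ofHom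
          (algebraMap O (MvPolynomial.homogeneousSubmodule (Fin (n + 1)) O 0)))) := by
  -- adapted from `Literature.AlgebraicGeometry.Motives.ProjectiveSpace.smoothOfRelativeDimension_projToSpec`
  refine IsZariskiLocalAtSource.of_openCover (P := @SmoothOfRelativeDimension n)
    (Proj.affineOpenCoverOfIrrelevantLESpan (MvPolynomial.homogeneousSubmodule (Fin (n + 1)) O)
      (fun s : Fin (n + 1) => (X s : MvPolynomial (Fin (n + 1)) O)) (m := fun _ => 1)
      (fun s => ProjectiveSpace.X_mem s) (fun _ => zero_lt_one) (irrelevant_le_span n O)).openCover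
    fun s : Fin (n + 1) => ?_
  -- the `s`-th chart is `Proj.awayι` for `xₛ`; restrict the structure morphism to it
  change SmoothOfRelativeDimension n
    (Proj.awayι (MvPolynomial.homogeneousSubmodule (Fin (n + 1)) O) (X s)
        (ProjectiveSpace.X_mem s) zero_lt_one ≫
      (Proj.toSpecZero (MvPolynomial.homogeneousSubmodule (Fin (n + 1)) O) ≫
        Spec.map (CommRingCat.ofHom
          (algebraMap O (MvPolynomial.homogeneousSubmodule (Fin (n + 1)) O 0)))))
  rw [Proj.awayι_toSpecZero_assoc, ← Spec.map_comp, ← CommRingCat.ofHom_comp,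
    HasRingHomProperty.Spec_iff (P := @SmoothOfRelativeDimension n)]
  -- `O → O[x]₀ → (O[x]_{xₛ})₀` is the structure map of the `O`-algebra `(O[x]_{xₛ})₀ ≅ O[y₁,…,yₙ]`
  letI : Algebra O (Away (MvPolynomial.homogeneousSubmodule (Fin (n + 1)) O) (X s)) :=
    ProjBaseChange.algebraBase _ _
  exact RingHom.locally_of RingHom.isStandardSmoothOfRelativeDimension_respectsIso _
    (ProjectiveSpace.algebraMap_isStandardSmoothOfRelativeDimension O s)

/-! ### The stub -/

/-- **`ℙⁿ_O → Spec O` is smooth and proper** for any commutative ring `O`: projective `n`-space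
`Proj O[x₀,…,xₙ] → Spec (O[x]₀) → Spec O` is smooth (of relative dimension `n`,
`smoothOfRelativeDimension_toSpecZero_specMap`) and proper (Mathlib: `Proj.toSpecZero` is proper for
`A` of finite type over `𝒜 0`; `Spec (O[x]₀) ≅ Spec O`).
[cite: Hartshorne1977, II Thm. 4.9 and III §10 Example 10.0.1] -/
theorem stub_projectiveAmbientSmoothProper : ∀ (O : Type) [CommRing O] (n : ℕ),
    AlgebraicGeometry.Smooth (Proj.toSpecZero (MvPolynomial.homogeneousSubmodule (Fin (n + 1)) O) ≫
      Spec.map (CommRingCat.ofHom (algebraMap O ((MvPolynomial.homogeneousSubmodule (Fin (n + 1)) O) 0)))) ∧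
    AlgebraicGeometry.IsProper (Proj.toSpecZero (MvPolynomial.homogeneousSubmodule (Fin (n + 1)) O) ≫
      Spec.map (CommRingCat.ofHom (algebraMap O ((MvPolynomial.homogeneousSubmodule (Fin (n + 1)) O) 0)))) := by
  intro O _ n
  haveI := smoothOfRelativeDimension_toSpecZero_specMap n O
  haveI := finiteType_homogeneousSubmodule_zero (Fin (n + 1)) O
  haveI := isIso_specMap_algebraMap_homogeneousSubmodule_zero n O
  exact ⟨SmoothOfRelativeDimension.smooth n _, inferInstance⟩

end Summit.ResolutionOfSingularities.ResolutionOfSingularities.Cruxes.EquisingularLift.StrataSplit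

end
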